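import Mathlib.Analysis.SpecialFunctions.Pow.Real
import Mathlib.Analysis.SpecialFunctions.Log.Basic
import Mathlib.Analysis.SpecialFunctions.Exp
import Mathlib.Analysis.SpecialFunctions.Pow.Asymptotics
import Mathlib.Analysis.Complex.ExponentialBounds
import HarnessLib

/-!
# Montgomery–Vaughan (1975), Lemma 4.3: the ranges `exp(log^{1/2} N) ≤ P ≤ N^{c₄}`, `T = P⁶`,
the scale `u₀ = ⌈N/P⁵⌉` and the error budget — PROVED real-variable bookkeeping

H. L. Montgomery, R. C. Vaughan, *The exceptional set in Goldbach's problem*, Acta Arith. 27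
(1975) 353–370 [MontgomeryVaughanActa1975], §4 Lemma 4.3: "provided `exp(log^{1/2} N) ≤ P ≤ N^{c₄}`",
"with `T = P⁶`". Elementary consequences used in the assembly of (4.2) from the explicit formulae
and a log-free density estimate (`MontgomeryVaughan1975Lemma43Assembly.lean`):

* `range_facts` — for `N ≥ 2`, `exp(√log N) ≤ P ≤ N^{c₄}`, `0 < c₄ ≤ 1/20`: `log P ≥ 1/c₄ ≥ 20`,
  `P ≥ 4`, `P⁵ ≤ N^{1/4}`, `P⁷ ≤ N`, `log² N ≤ 24 P`, …;
* `scale_facts` — with moreover `c₄ ≤ 1/(6 + 2c_D)`: the scale `u₀ = ⌈N/P⁵⌉` satisfies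
  `2 ≤ u₀ ≤ N`, `N/P⁵ ≤ u₀ ≤ N/P⁵ + 1`, `(P^{c_D})² ≤ u₀`;
* `error_budget_le` — the negligible terms:
  `(2P³/N)((log 4 + 2)(N/P⁵ + 1) + E + E_ζ + 1) ≤ (100 + 200K + 200C)/P²` where
  `E = 2√N log N + 2 log(N+1) + K(log N + (N/P⁶) log²(P N P⁶))`,
  `E_ζ = 2√N log N + 2 log N + 1 + C(log N + (N/P⁶) log²(N P⁶))`;
* `saving_le` — `(P^{c_D}/u₀)^{c/log P} ≤ e^{c(5 + c_D)} exp(−c log N/log P)`;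
* `inv_sq_le_exc_factor` — `P⁻² ≤ (2/C_S) · (C_S r^{−1/8}) (log P) exp(−c log N/log P)` hmm, in
  the form used with Siegel's bound: `M/P² ≤ (2M/C_S)((1 − β) log P) exp(−c log N/log P)` when
  `C_S P^{−1/8} ≤ 1 − β`, `c ≤ 1`.

No number theory; no named facts.
-/

noncomputable section

open Real

namespace Literature.NumberTheory.Sieve.MontgomeryVaughan1975

/-! ### The range `exp(log^{1/2} N) ≤ P ≤ N^{c₄}` -/

/-- `s⁴ ≤ 24 e^s` for `s ≥ 0`. [folklore] -/
theorem pow_four_le_mul_exp {s : ℝ} (hs : 0 ≤ s) : s ^ 4 ≤ 24 * Real.exp s := by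
  have h := Real.pow_div_factorial_le_exp s hs 4
  have h24 : (Nat.factorial 4 : ℝ) = 24 := by norm_num [Nat.factorial]
  rw [h24, div_le_iff₀ (by norm_num)] at h
  linarith

/-- **Consequences of the range of Lemma 4.3**: for `N ≥ 2`, `exp(√log N) ≤ P ≤ N^{c₄}` with
`0 < c₄ ≤ 1/20`: `1/c₄ ≤ log P`, `20 ≤ log P`, `4 ≤ P`, `P ≤ N`, `P⁷ ≤ N`, `P⁵ ≤ N^{1/4}`,
`log² N ≤ 24 P`, `log N ≤ 4 N^{1/4}`. [cite: MontgomeryVaughanActa1975, §4 Lemma 4.3] -/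
theorem range_facts {N : ℕ} (hN : 2 ≤ N) {P c₄ : ℝ} (hc₄ : 0 < c₄) (hc₄' : c₄ ≤ 1 / 20)
    (hP : Real.exp (Real.sqrt (Real.log N)) ≤ P) (hPN : P ≤ (N : ℝ) ^ c₄) :
    1 / c₄ ≤ Real.log P ∧ 20 ≤ Real.log P ∧ 4 ≤ P ∧ P ≤ N ∧ P ^ 7 ≤ N ∧
      P ^ 5 ≤ (N : ℝ) ^ (1 / 4 : ℝ) ∧ Real.log N ^ 2 ≤ 24 * P ∧
      Real.log N ≤ 4 * (N : ℝ) ^ (1 / 4 : ℝ) := by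
  have hN2 : (2 : ℝ) ≤ N := by exact_mod_cast hN
  have hN0 : (0 : ℝ) < N := by linarith
  have hN1 : (1 : ℝ) ≤ N := by linarith
  have hlogN : 0 < Real.log N := Real.log_pos (by linarith)
  have hP0 : 0 < P := lt_of_lt_of_le (Real.exp_pos _) hP
  have hsqrt : Real.sqrt (Real.log N) ≤ Real.log P := by
    have := Real.log_le_log (Real.exp_pos _) hP
    rwa [Real.log_exp] at this
  have hlogPN : Real.log P ≤ c₄ * Real.log N := by
    have := Real.log_le_log hP0 hPN
    rwa [Real.log_rpow hN0] at this
  have hs0 : 0 < Real.sqrt (Real.log N) := Real.sqrt_pos.mpr hlogN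
  -- `1 ≤ c₄ √log N`
  have hkey : 1 ≤ c₄ * Real.sqrt (Real.log N) := by
    have h1 : Real.sqrt (Real.log N) ≤ c₄ * Real.log N := hsqrt.trans hlogPN
    have h2 : Real.sqrt (Real.log N) * Real.sqrt (Real.log N) = Real.log N :=
      Real.mul_self_sqrt hlogN.le
    have h3 : 1 * Real.sqrt (Real.log N) ≤ (c₄ * Real.sqrt (Real.log N)) * Real.sqrt (Real.log N) := by
      rw [one_mul, mul_assoc, h2]; exact h1
    exact le_of_mul_le_mul_right h3 hs0
  have hinv : 1 / c₄ ≤ Real.sqrt (Real.log N) := by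
    rw [div_le_iff₀ hc₄]; linarith [mul_comm c₄ (Real.sqrt (Real.log N))]
  have h1c : 1 / c₄ ≤ Real.log P := hinv.trans hsqrt
  have h20c : (20 : ℝ) ≤ 1 / c₄ := by
    rw [le_div_iff₀ hc₄]; linarith
  have h20 : 20 ≤ Real.log P := h20c.trans h1c
  have hP4 : 4 ≤ P := by
    have h2 : Real.log 4 ≤ Real.log P := by
      have : Real.log 4 ≤ 4 := by
        have := Real.log_le_sub_one_of_pos (by norm_num : (0:ℝ) < 4); linarith
      linarith
    exact (Real.log_le_log_iff (by norm_num) hP0).mp h2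
  -- powers of `P` against `N`
  have hPN1 : P ≤ N := hPN.trans (by
    calc (N : ℝ) ^ c₄ ≤ (N : ℝ) ^ (1 : ℝ) := Real.rpow_le_rpow_of_exponent_le hN1 (by linarith)
      _ = N := Real.rpow_one _)
  have hP7 : P ^ 7 ≤ N := by
    calc P ^ 7 ≤ ((N : ℝ) ^ c₄) ^ 7 := by gcongr
      _ = (N : ℝ) ^ (7 * c₄) := by
          rw [← Real.rpow_natCast, ← Real.rpow_mul hN0.le]; congr 1; push_cast; ring
      _ ≤ (N : ℝ) ^ (1 : ℝ) := Real.rpow_le_rpow_of_exponent_le hN1 (by linarith)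
      _ = N := Real.rpow_one _
  have hP5 : P ^ 5 ≤ (N : ℝ) ^ (1 / 4 : ℝ) := by
    calc P ^ 5 ≤ ((N : ℝ) ^ c₄) ^ 5 := by gcongr
      _ = (N : ℝ) ^ (5 * c₄) := by
          rw [← Real.rpow_natCast, ← Real.rpow_mul hN0.le]; congr 1; push_cast; ring
      _ ≤ (N : ℝ) ^ (1 / 4 : ℝ) := Real.rpow_le_rpow_of_exponent_le hN1 (by linarith)
  -- `log² N = (√log N)⁴ ≤ 24 exp(√log N) ≤ 24 P`
  have hlog2 : Real.log N ^ 2 ≤ 24 * P := by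
    have h1 := pow_four_le_mul_exp hs0.le
    have h2 : Real.sqrt (Real.log N) ^ 4 = Real.log N ^ 2 := by
      rw [show (4 : ℕ) = 2 * 2 by norm_num, pow_mul, Real.sq_sqrt hlogN.le]
    rw [h2] at h1
    linarith [mul_le_mul_of_nonneg_left hP (by norm_num : (0:ℝ) ≤ 24)]
  have hlog4 : Real.log N ≤ 4 * (N : ℝ) ^ (1 / 4 : ℝ) := by
    have := Real.log_le_rpow_div hN0.le (by norm_num : (0 : ℝ) < 1 / 4)
    linarith [show (N : ℝ) ^ (1 / 4 : ℝ) / (1 / 4) = 4 * (N : ℝ) ^ (1 / 4 : ℝ) by ring]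
  exact ⟨h1c, h20, hP4, hPN1, hP7, hP5, hlog2, hlog4⟩

/-! ### The scale `u₀ = ⌈N/P⁵⌉` -/

/-- **The scale `u₀ = ⌈N/P⁵⌉`**: for `N ≥ 2`, `2 ≤ P ≤ N^{c₄}` with `0 < c₄ ≤ 1/(6 + 2c_D)`
(`c_D > 0`): `P^{6 + 2c_D} ≤ N`, and `u₀ = ⌈N/P⁵⌉` satisfies `2 ≤ u₀`, `u₀ ≤ N`,
`N/P⁵ ≤ u₀ ≤ N/P⁵ + 1` and `(P^{c_D})² ≤ u₀`. [cite: MontgomeryVaughanActa1975, §4 Lemma 4.3] -/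
theorem scale_facts {N : ℕ} (hN : 2 ≤ N) {P c₄ c_D : ℝ} (hP : 2 ≤ P) (hcD : 0 < c_D)
    (hc₄' : c₄ ≤ 1 / (6 + 2 * c_D)) (hPN : P ≤ (N : ℝ) ^ c₄) :
    P ^ (6 + 2 * c_D) ≤ N ∧
      2 ≤ ⌈(N : ℝ) / P ^ 5⌉₊ ∧ ⌈(N : ℝ) / P ^ 5⌉₊ ≤ N ∧
      (N : ℝ) / P ^ 5 ≤ ⌈(N : ℝ) / P ^ 5⌉₊ ∧ (⌈(N : ℝ) / P ^ 5⌉₊ : ℝ) ≤ (N : ℝ) / P ^ 5 + 1 ∧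
      (P ^ c_D) ^ 2 ≤ (⌈(N : ℝ) / P ^ 5⌉₊ : ℝ) := by
  have hN2 : (2 : ℝ) ≤ N := by exact_mod_cast hN
  have hN0 : (0 : ℝ) < N := by linarith
  have hN1 : (1 : ℝ) ≤ N := by linarith
  have hP0 : 0 < P := by linarith
  have hP1 : 1 ≤ P := by linarith
  have h6 : 0 < 6 + 2 * c_D := by linarith
  -- `P^{6+2c_D} ≤ N`
  have hpow : P ^ (6 + 2 * c_D) ≤ N := by
    calc P ^ (6 + 2 * c_D) ≤ ((N : ℝ) ^ c₄) ^ (6 + 2 * c_D) :=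
          Real.rpow_le_rpow hP0.le hPN h6.le
      _ = (N : ℝ) ^ (c₄ * (6 + 2 * c_D)) := by rw [← Real.rpow_mul hN0.le]
      _ ≤ (N : ℝ) ^ (1 : ℝ) := by
          apply Real.rpow_le_rpow_of_exponent_le hN1
          calc c₄ * (6 + 2 * c_D) ≤ 1 / (6 + 2 * c_D) * (6 + 2 * c_D) :=
                mul_le_mul_of_nonneg_right hc₄' h6.le
            _ = 1 := by field_simp
      _ = N := Real.rpow_one _
  -- `N/P⁵ ≥ P^{1 + 2c_D} ≥ P ≥ 2` and `≥ (P^{c_D})²`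
  have h5 : P ^ (5 : ℝ) = P ^ 5 := by exact_mod_cast Real.rpow_natCast P 5
  have hsplit : P ^ (6 + 2 * c_D) = P ^ 5 * P ^ (1 + 2 * c_D) := by
    rw [show (6 + 2 * c_D) = 5 + (1 + 2 * c_D) by ring, Real.rpow_add hP0, h5]
  have hP5 : 0 < P ^ 5 := by positivity
  have hquot : P ^ (1 + 2 * c_D) ≤ (N : ℝ) / P ^ 5 := by
    rw [le_div_iff₀ hP5]
    calc P ^ (1 + 2 * c_D) * P ^ 5 = P ^ (6 + 2 * c_D) := by rw [hsplit]; ring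
      _ ≤ N := hpow
  have hP12 : P ≤ P ^ (1 + 2 * c_D) := by
    calc P = P ^ (1 : ℝ) := (Real.rpow_one P).symm
      _ ≤ P ^ (1 + 2 * c_D) := Real.rpow_le_rpow_of_exponent_le hP1 (by linarith)
  have hB2 : (P ^ c_D) ^ 2 ≤ P ^ (1 + 2 * c_D) := by
    rw [← Real.rpow_natCast, ← Real.rpow_mul hP0.le]
    exact Real.rpow_le_rpow_of_exponent_le hP1 (by norm_num; linarith)
  set u₀ := ⌈(N : ℝ) / P ^ 5⌉₊ with hu₀
  have hceil : (N : ℝ) / P ^ 5 ≤ u₀ := Nat.le_ceil _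
  have hq0 : 0 ≤ (N : ℝ) / P ^ 5 := by positivity
  have hceil' : (u₀ : ℝ) ≤ (N : ℝ) / P ^ 5 + 1 := (Nat.ceil_lt_add_one hq0).le
  have hu2r : (2 : ℝ) ≤ u₀ := by linarith
  have hu2 : 2 ≤ u₀ := by exact_mod_cast hu2r
  have huN : u₀ ≤ N := by
    have h32 : (32 : ℝ) ≤ P ^ 5 := by nlinarith [pow_le_pow_left₀ (by norm_num : (0:ℝ) ≤ 2) hP 5]
    have h1 : (N : ℝ) / P ^ 5 ≤ N / 32 := div_le_div_of_nonneg_left hN0.le (by norm_num) h32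
    have h2 : (u₀ : ℝ) ≤ N := by linarith
    exact_mod_cast h2
  exact ⟨hpow, hu2, huN, hceil, hceil', hB2.trans (hquot.trans hceil)⟩

/-! ### The error budget -/

/-- **The negligible terms**: for `N ≥ 2` and `P` in the range of Lemma 4.3 (through the
consequences `4 ≤ P ≤ N`, `P⁷ ≤ N`, `P⁵ ≤ N^{1/4}`, `log² N ≤ 24P`, `log N ≤ 4N^{1/4}`) and
`K, C ≥ 0`:
`(2P³/N)((log 4 + 2)(N/P⁵ + 1) + E + E_ζ + 1) ≤ (100 + 200K + 200C)/P²`,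
`E = 2√N log N + 2 log(N+1) + K(log N + (N/P⁶) log²(P N P⁶))`,
`E_ζ = 2√N log N + 2 log N + 1 + C(log N + (N/P⁶) log²(N P⁶))`. [folklore] -/
theorem error_budget_le {N : ℕ} (hN : 2 ≤ N) {P K C : ℝ} (hP4 : 4 ≤ P) (hPN : P ≤ N)
    (hP7 : P ^ 7 ≤ N) (hP5 : P ^ 5 ≤ (N : ℝ) ^ (1 / 4 : ℝ)) (hlog2 : Real.log N ^ 2 ≤ 24 * P)
    (hlog4 : Real.log N ≤ 4 * (N : ℝ) ^ (1 / 4 : ℝ)) (hK : 0 ≤ K) (hC : 0 ≤ C) :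
    2 * P ^ 3 / N * ((Real.log 4 + 2) * ((N : ℝ) / P ^ 5 + 1) +
        (2 * Real.sqrt N * Real.log N + 2 * Real.log (N + 1) +
          K * (Real.log N + N / P ^ 6 * Real.log (P * N * P ^ 6) ^ 2)) +
        (2 * Real.sqrt N * Real.log N + 2 * Real.log N + 1 +
          C * (Real.log N + N / P ^ 6 * Real.log (N * P ^ 6) ^ 2)) + 1) ≤
      (100 + 200 * K + 200 * C) / P ^ 2 := by
  have hN2 : (2 : ℝ) ≤ N := by exact_mod_cast hN
  have hN0 : (0 : ℝ) < N := by linarith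
  have hN1 : (1 : ℝ) ≤ N := by linarith
  have hP0 : 0 < P := by linarith
  have hP1 : 1 ≤ P := by linarith
  have hlogN0 : 0 ≤ Real.log N := Real.log_nonneg hN1
  have hlog4c : Real.log 4 ≤ 2 := by
    have h4 : Real.log 4 = 2 * Real.log 2 := by
      rw [show (4 : ℝ) = 2 ^ 2 by norm_num, Real.log_pow]; norm_num
    rw [h4]
    linarith [Real.log_two_lt_d9]
  set Q : ℝ := (N : ℝ) ^ (1 / 4 : ℝ) with hQ
  have hQ0 : 0 < Q := Real.rpow_pos_of_pos hN0 _
  have hQ1 : 1 ≤ Q := Real.one_le_rpow hN1 (by norm_num)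
  have hQ4 : Q ^ 4 = N := by
    rw [hQ, ← Real.rpow_natCast, ← Real.rpow_mul hN0.le]; norm_num
  have hsqrtN : Real.sqrt N = Q ^ 2 := by
    rw [hQ, ← Real.rpow_natCast, ← Real.rpow_mul hN0.le, Real.sqrt_eq_rpow]; norm_num
  -- the key ratio `P³/Q ≤ 1/P²` i.e. `P⁵ ≤ Q`
  have hP5Q : P ^ 5 ≤ Q := hP5
  have hP2 : 0 < P ^ 2 := by positivity
  have hP3 : 0 < P ^ 3 := by positivity
  -- logs
  have hlogN1 : Real.log (N + 1) ≤ 1 + Real.log N := by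
    have h1 : Real.log (N + 1) ≤ Real.log (2 * N) := Real.log_le_log (by linarith) (by linarith)
    rw [Real.log_mul (by norm_num) hN0.ne'] at h1
    linarith [Real.log_two_lt_d9]
  have hlogPN : Real.log (P * N * P ^ 6) ≤ 2 * Real.log N := by
    have h1 : P * N * P ^ 6 = N * P ^ 7 := by ring
    have h2 : N * P ^ 7 ≤ N * N := mul_le_mul_of_nonneg_left hP7 hN0.le
    calc Real.log (P * N * P ^ 6) ≤ Real.log (N * N) := by
          rw [h1]; exact Real.log_le_log (by positivity) h2
      _ = 2 * Real.log N := by rw [Real.log_mul hN0.ne' hN0.ne']; ring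
  have hlogN6 : Real.log (N * P ^ 6) ≤ 2 * Real.log N := by
    have h2 : N * P ^ 6 ≤ N * N := by
      apply mul_le_mul_of_nonneg_left _ hN0.le
      calc P ^ 6 ≤ P ^ 7 := pow_le_pow_right₀ hP1 (by norm_num)
        _ ≤ N := hP7
    calc Real.log (N * P ^ 6) ≤ Real.log (N * N) := Real.log_le_log (by positivity) h2
      _ = 2 * Real.log N := by rw [Real.log_mul hN0.ne' hN0.ne']; ring
  have hlogPN0 : 0 ≤ Real.log (P * N * P ^ 6) := Real.log_nonneg (by
    have : 1 ≤ P * N := by nlinarith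
    calc (1 : ℝ) ≤ P * N := this
      _ ≤ P * N * P ^ 6 := le_mul_of_one_le_right (by positivity) (one_le_pow₀ hP1))
  have hlogN60 : 0 ≤ Real.log (N * P ^ 6) := Real.log_nonneg (by
    calc (1 : ℝ) ≤ N := hN1
      _ ≤ N * P ^ 6 := le_mul_of_one_le_right hN0.le (one_le_pow₀ hP1))
  have hsq1 : Real.log (P * N * P ^ 6) ^ 2 ≤ 4 * Real.log N ^ 2 := by
    nlinarith [pow_le_pow_left₀ hlogPN0 hlogPN 2]
  have hsq2 : Real.log (N * P ^ 6) ^ 2 ≤ 4 * Real.log N ^ 2 := by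
    nlinarith [pow_le_pow_left₀ hlogN60 hlogN6 2]
  -- useful products
  have hP5N : P ^ 5 ≤ N := by
    calc P ^ 5 ≤ P ^ 7 := pow_le_pow_right₀ hP1 (by norm_num)
      _ ≤ N := hP7
  have hA : P ^ 5 * Q ^ 3 ≤ N := by
    calc P ^ 5 * Q ^ 3 ≤ Q * Q ^ 3 := mul_le_mul_of_nonneg_right hP5Q (by positivity)
      _ = N := by rw [← hQ4]; ring
  have hQ3 : Q ≤ Q ^ 3 := by
    calc Q = Q ^ 1 := (pow_one Q).symm
      _ ≤ Q ^ 3 := pow_le_pow_right₀ hQ1 (by norm_num)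
  have hA' : P ^ 5 * Q ≤ N := (mul_le_mul_of_nonneg_left hQ3 (by positivity)).trans hA
  -- Now bound term by term (all as `2 P⁵ · term ≤ c · N`).
  have hl42 : 0 ≤ Real.log 4 + 2 := by linarith [Real.log_nonneg (by norm_num : (1:ℝ) ≤ 4)]
  -- (1) `(log4+2)(N/P⁵+1)`: `2P⁵(log4+2)(N/P⁵+1) = 2(log4+2)(N + P⁵) ≤ 16 N`
  have t1 : 2 * P ^ 5 * ((Real.log 4 + 2) * ((N : ℝ) / P ^ 5 + 1)) ≤ 16 * N := by
    have h1 : 2 * P ^ 5 * ((Real.log 4 + 2) * ((N : ℝ) / P ^ 5 + 1)) =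
        2 * (Real.log 4 + 2) * (N + P ^ 5) := by
      field_simp
    rw [h1]
    have h2 : (N : ℝ) + P ^ 5 ≤ 2 * N := by linarith
    nlinarith [mul_le_mul_of_nonneg_left h2 hl42]
  -- (2) `2√N log N = 2 Q² log N ≤ 8 Q³`: `2P⁵ · 8Q³ ≤ 16 N`
  have t2 : 2 * P ^ 5 * (2 * Real.sqrt N * Real.log N) ≤ 16 * N := by
    rw [hsqrtN]
    have h1 : Q ^ 2 * Real.log N ≤ 4 * Q ^ 3 := by
      calc Q ^ 2 * Real.log N ≤ Q ^ 2 * (4 * Q) := mul_le_mul_of_nonneg_left hlog4 (sq_nonneg Q)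
        _ = 4 * Q ^ 3 := by ring
    calc 2 * P ^ 5 * (2 * Q ^ 2 * Real.log N) = 4 * P ^ 5 * (Q ^ 2 * Real.log N) := by ring
      _ ≤ 4 * P ^ 5 * (4 * Q ^ 3) := mul_le_mul_of_nonneg_left h1 (by positivity)
      _ = 16 * (P ^ 5 * Q ^ 3) := by ring
      _ ≤ 16 * N := by linarith [hA]
  -- (3) `2 log(N+1) ≤ 2 + 8Q`: `2P⁵(2 + 8Q) ≤ 4N + 16N`
  have t3 : 2 * P ^ 5 * (2 * Real.log (N + 1)) ≤ 20 * N := by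
    have h1 : Real.log (N + 1) ≤ 1 + 4 * Q := by linarith
    calc 2 * P ^ 5 * (2 * Real.log (N + 1)) ≤ 2 * P ^ 5 * (2 * (1 + 4 * Q)) := by
          apply mul_le_mul_of_nonneg_left _ (by positivity); linarith
      _ = 4 * P ^ 5 + 16 * (P ^ 5 * Q) := by ring
      _ ≤ 4 * N + 16 * N := by linarith [hP5N, hA']
      _ = 20 * N := by ring
  -- (4) `K log N ≤ 4K Q`: `2P⁵ · 4KQ ≤ 8K N`
  have t4 : 2 * P ^ 5 * (K * Real.log N) ≤ 8 * K * N := by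
    calc 2 * P ^ 5 * (K * Real.log N) ≤ 2 * P ^ 5 * (K * (4 * Q)) := by
          apply mul_le_mul_of_nonneg_left (mul_le_mul_of_nonneg_left hlog4 hK) (by positivity)
      _ = 8 * K * (P ^ 5 * Q) := by ring
      _ ≤ 8 * K * N := mul_le_mul_of_nonneg_left hA' (by positivity)
  -- (5) `K (N/P⁶) log²(PNP⁶) ≤ K (N/P⁶) · 96P`: `2P⁵ · K (N/P⁶)(96 P) = 192 K N`
  have t5 : 2 * P ^ 5 * (K * (N / P ^ 6 * Real.log (P * N * P ^ 6) ^ 2)) ≤ 192 * K * N := by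
    have h1 : N / P ^ 6 * Real.log (P * N * P ^ 6) ^ 2 ≤ N / P ^ 6 * (96 * P) := by
      apply mul_le_mul_of_nonneg_left _ (by positivity)
      linarith
    have h2 : 2 * P ^ 5 * (K * (N / P ^ 6 * (96 * P))) = 192 * K * N := by
      field_simp
      ring
    calc 2 * P ^ 5 * (K * (N / P ^ 6 * Real.log (P * N * P ^ 6) ^ 2))
        ≤ 2 * P ^ 5 * (K * (N / P ^ 6 * (96 * P))) := by
          apply mul_le_mul_of_nonneg_left (mul_le_mul_of_nonneg_left h1 hK) (by positivity)
      _ = 192 * K * N := h2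
  -- (6) `2 log N + 1 ≤ 8Q + 1`: `2P⁵(8Q+1) ≤ 16N + 2N`
  have t6 : 2 * P ^ 5 * (2 * Real.log N + 1) ≤ 18 * N := by
    calc 2 * P ^ 5 * (2 * Real.log N + 1) ≤ 2 * P ^ 5 * (2 * (4 * Q) + 1) := by
          apply mul_le_mul_of_nonneg_left _ (by positivity); linarith
      _ = 16 * (P ^ 5 * Q) + 2 * P ^ 5 := by ring
      _ ≤ 16 * N + 2 * N := by linarith [hA', hP5N]
      _ = 18 * N := by ring
  -- (7) `C log N`, (8) `C (N/P⁶) log²(NP⁶)`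
  have t7 : 2 * P ^ 5 * (C * Real.log N) ≤ 8 * C * N := by
    calc 2 * P ^ 5 * (C * Real.log N) ≤ 2 * P ^ 5 * (C * (4 * Q)) := by
          apply mul_le_mul_of_nonneg_left (mul_le_mul_of_nonneg_left hlog4 hC) (by positivity)
      _ = 8 * C * (P ^ 5 * Q) := by ring
      _ ≤ 8 * C * N := mul_le_mul_of_nonneg_left hA' (by positivity)
  have t8 : 2 * P ^ 5 * (C * (N / P ^ 6 * Real.log (N * P ^ 6) ^ 2)) ≤ 192 * C * N := by
    have h1 : N / P ^ 6 * Real.log (N * P ^ 6) ^ 2 ≤ N / P ^ 6 * (96 * P) := by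
      apply mul_le_mul_of_nonneg_left _ (by positivity)
      linarith
    have h2 : 2 * P ^ 5 * (C * (N / P ^ 6 * (96 * P))) = 192 * C * N := by
      field_simp
      ring
    calc 2 * P ^ 5 * (C * (N / P ^ 6 * Real.log (N * P ^ 6) ^ 2))
        ≤ 2 * P ^ 5 * (C * (N / P ^ 6 * (96 * P))) := by
          apply mul_le_mul_of_nonneg_left (mul_le_mul_of_nonneg_left h1 hC) (by positivity)
      _ = 192 * C * N := h2
  -- (9) the `+1`: `2P⁵ ≤ 2N`
  have t9 : 2 * P ^ 5 * 1 ≤ 2 * N := by linarith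
  -- combine: the claim is `(2P³/N)·X ≤ M/P²`, i.e. `2P⁵ X ≤ M N`
  set X : ℝ := (Real.log 4 + 2) * ((N : ℝ) / P ^ 5 + 1) +
        (2 * Real.sqrt N * Real.log N + 2 * Real.log (N + 1) +
          K * (Real.log N + N / P ^ 6 * Real.log (P * N * P ^ 6) ^ 2)) +
        (2 * Real.sqrt N * Real.log N + 2 * Real.log N + 1 +
          C * (Real.log N + N / P ^ 6 * Real.log (N * P ^ 6) ^ 2)) + 1 with hX
  have key : 2 * P ^ 5 * X ≤ (100 + 200 * K + 200 * C) * N := by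
    have hexp : 2 * P ^ 5 * X =
      2 * P ^ 5 * ((Real.log 4 + 2) * ((N : ℝ) / P ^ 5 + 1)) +
      (2 * P ^ 5 * (2 * Real.sqrt N * Real.log N) + 2 * P ^ 5 * (2 * Real.log (N + 1)) +
        (2 * P ^ 5 * (K * Real.log N) + 2 * P ^ 5 * (K * (N / P ^ 6 * Real.log (P * N * P ^ 6) ^ 2)))) +
      (2 * P ^ 5 * (2 * Real.sqrt N * Real.log N) + 2 * P ^ 5 * (2 * Real.log N + 1) +
        (2 * P ^ 5 * (C * Real.log N) + 2 * P ^ 5 * (C * (N / P ^ 6 * Real.log (N * P ^ 6) ^ 2)))) +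
      2 * P ^ 5 * 1 := by rw [hX]; ring
    rw [hexp]
    linarith [t1, t2, t3, t4, t5, t6, t7, t8, t9]
  have h1 : 2 * P ^ 3 / N * X = (2 * P ^ 5 * X) / (N * P ^ 2) := by
    field_simp
  have h2 : (100 + 200 * K + 200 * C) / P ^ 2 = ((100 + 200 * K + 200 * C) * N) / (N * P ^ 2) := by
    field_simp
  rw [h1, h2]
  exact div_le_div_of_nonneg_right key (by positivity)

/-! ### The saving and the exceptional factor -/

/-- **The saving**: `(B/u₀)^η ≤ e^{c(5 + c_D)} exp(−c log N/log P)` for `B = P^{c_D}`,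
`η = c/log P`, `u₀ ≥ N/P⁵ > 0`, `c ≥ 0`, `P > 1`. [cite: Gallagher1970, §5] -/
theorem saving_le {N P c c_D u₀ : ℝ} (hN : 0 < N) (hP : 1 < P) (hc : 0 ≤ c)
    (hu₀ : N / P ^ 5 ≤ u₀) :
    (P ^ c_D / u₀) ^ (c / Real.log P) ≤
      Real.exp (c * (5 + c_D)) * Real.exp (-c * Real.log N / Real.log P) := by
  have hP0 : 0 < P := by linarith
  have hlogP : 0 < Real.log P := Real.log_pos hP
  have hq0 : 0 < N / P ^ 5 := by positivity
  have hu₀0 : 0 < u₀ := lt_of_lt_of_le hq0 hu₀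
  have hB0 : 0 < P ^ c_D := Real.rpow_pos_of_pos hP0 _
  have hη : 0 ≤ c / Real.log P := div_nonneg hc hlogP.le
  -- `B/u₀ ≤ B P⁵/N = P^{5 + c_D}/N`
  have h1 : P ^ c_D / u₀ ≤ P ^ (5 + c_D) / N := by
    rw [div_le_div_iff₀ hu₀0 hN]
    have h2 : P ^ (5 + c_D) = P ^ 5 * P ^ c_D := by
      have h5 : P ^ (5 : ℝ) = P ^ 5 := by exact_mod_cast Real.rpow_natCast P 5
      rw [Real.rpow_add hP0, h5]
    rw [h2]
    have h3 : P ^ c_D * N ≤ P ^ c_D * (P ^ 5 * u₀) := by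
      apply mul_le_mul_of_nonneg_left _ hB0.le
      rwa [div_le_iff₀ (by positivity), mul_comm] at hu₀
    nlinarith
  calc (P ^ c_D / u₀) ^ (c / Real.log P) ≤ (P ^ (5 + c_D) / N) ^ (c / Real.log P) :=
        Real.rpow_le_rpow (by positivity) h1 hη
    _ = Real.exp (Real.log (P ^ (5 + c_D) / N) * (c / Real.log P)) :=
        Real.rpow_def_of_pos (by positivity) _
    _ = Real.exp (c * (5 + c_D)) * Real.exp (-c * Real.log N / Real.log P) := by
        rw [← Real.exp_add, Real.log_div (by positivity) hN.ne', Real.log_rpow hP0]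
        congr 1
        field_simp
        ring

/-- **The exceptional factor absorbs `P⁻²`**: if `C_S r^{−1/8} ≤ 1 − β` with `1 ≤ r ≤ P`,
`P ≥ 2`, `0 ≤ c ≤ 1`, `log N ≤ log² P` (i.e. `P ≥ exp(log^{1/2} N)`), `C_S > 0`, `M ≥ 0`, then
`M/P² ≤ (2M/C_S) ((1 − β) log P) exp(−c log N/log P)`. [folklore] -/
theorem div_sq_le_exc_factor {M C_S P r β c LN : ℝ} (hM : 0 ≤ M) (hCS : 0 < C_S) (hP : 2 ≤ P)
    (hr1 : 1 ≤ r) (hrP : r ≤ P) (hSiegel : C_S * r ^ (-(1 / 8 : ℝ)) ≤ 1 - β)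
    (hc1 : c ≤ 1) (hLN0 : 0 ≤ LN) (hLN : LN ≤ Real.log P ^ 2) :
    M / P ^ 2 ≤ 2 * M / C_S * ((1 - β) * Real.log P) * Real.exp (-c * LN / Real.log P) := by
  have hP0 : 0 < P := by linarith
  have hP1 : 1 ≤ P := by linarith
  have hr0 : 0 < r := by linarith
  have hlog2 : (1 / 2 : ℝ) ≤ Real.log P := by
    have h2 : Real.log 2 ≤ Real.log P := Real.log_le_log two_pos hP
    have := Real.log_two_gt_d9
    linarith
  have hlogP : 0 < Real.log P := by linarith
  -- `1 − β ≥ C_S P^{−1/8}`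
  have hrP8 : P ^ (-(1 / 8 : ℝ)) ≤ r ^ (-(1 / 8 : ℝ)) :=
    Real.rpow_le_rpow_of_nonpos hr0 hrP (by norm_num)
  have hβ : C_S * P ^ (-(1 / 8 : ℝ)) ≤ 1 - β :=
    (mul_le_mul_of_nonneg_left hrP8 hCS.le).trans hSiegel
  -- `exp(−c LN/log P) ≥ exp(−log P) = 1/P`
  have hexp : P⁻¹ ≤ Real.exp (-c * LN / Real.log P) := by
    have h1 : P⁻¹ = Real.exp (-Real.log P) := by rw [Real.exp_neg, Real.exp_log hP0]
    rw [h1, Real.exp_le_exp, neg_mul, neg_div, neg_le_neg_iff, div_le_iff₀ hlogP]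
    calc c * LN ≤ 1 * Real.log P ^ 2 := mul_le_mul hc1 hLN hLN0 zero_le_one
      _ = Real.log P * Real.log P := by ring
  -- `P^{−2} = P^{−1/8} · P^{−1} · P^{−7/8} ≤ P^{−1/8} · P^{−1}`
  have hP18 : 0 < P ^ (-(1 / 8 : ℝ)) := Real.rpow_pos_of_pos hP0 _
  have hsplit : (P ^ 2)⁻¹ ≤ P ^ (-(1 / 8 : ℝ)) * P⁻¹ := by
    have h1 : P ^ (-(1 / 8 : ℝ)) * P⁻¹ = P ^ (-(9 / 8 : ℝ)) := by
      rw [← Real.rpow_neg_one, ← Real.rpow_add hP0]; norm_num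
    have h2 : (P ^ 2)⁻¹ = P ^ (-(2 : ℝ)) := by
      rw [Real.rpow_neg hP0.le, Real.rpow_two]
    rw [h1, h2]
    exact Real.rpow_le_rpow_of_exponent_le hP1 (by norm_num)
  have h1β : 0 ≤ 1 - β := by
    have := mul_pos hCS hP18
    linarith
  have hmain : (P ^ 2)⁻¹ ≤ (2 / C_S) * ((1 - β) * Real.log P) * Real.exp (-c * LN / Real.log P) := by
    calc (P ^ 2)⁻¹ ≤ P ^ (-(1 / 8 : ℝ)) * P⁻¹ := hsplit
      _ ≤ ((1 - β) / C_S) * P⁻¹ := by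
          apply mul_le_mul_of_nonneg_right _ (inv_nonneg.mpr hP0.le)
          rw [le_div_iff₀ hCS]; linarith
      _ ≤ ((1 - β) / C_S) * Real.exp (-c * LN / Real.log P) :=
          mul_le_mul_of_nonneg_left hexp (div_nonneg h1β hCS.le)
      _ ≤ (2 / C_S) * ((1 - β) * Real.log P) * Real.exp (-c * LN / Real.log P) := by
          apply mul_le_mul_of_nonneg_right _ (Real.exp_pos _).le
          -- `(1 − β)/C_S ≤ (2/C_S)(1 − β) log P` since `log P ≥ 1/2`
          have h1 : (1 - β) / C_S = (2 / C_S) * ((1 - β) * (1 / 2)) := by field_simp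
          rw [h1]
          apply mul_le_mul_of_nonneg_left _ (by positivity)
          exact mul_le_mul_of_nonneg_left hlog2 h1β
  calc M / P ^ 2 = M * (P ^ 2)⁻¹ := by rw [div_eq_mul_inv]
    _ ≤ M * ((2 / C_S) * ((1 - β) * Real.log P) * Real.exp (-c * LN / Real.log P)) :=
        mul_le_mul_of_nonneg_left hmain hM
    _ = 2 * M / C_S * ((1 - β) * Real.log P) * Real.exp (-c * LN / Real.log P) := by ring

/-- `P⁻² ≤ exp(−c log N/log P)` in the range (`0 ≤ c ≤ 1`, `log N ≤ log² P`, `P ≥ 1`). [folklore] -/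
theorem inv_sq_le_exp_neg {P c LN : ℝ} (hP : 1 ≤ P) (hc1 : c ≤ 1) (hLN0 : 0 ≤ LN)
    (hLN : LN ≤ Real.log P ^ 2) : (P ^ 2)⁻¹ ≤ Real.exp (-c * LN / Real.log P) := by
  have hP0 : 0 < P := by linarith
  have hlogP : 0 ≤ Real.log P := Real.log_nonneg hP
  have h1 : (P ^ 2)⁻¹ ≤ P⁻¹ := by
    apply inv_anti₀ hP0
    nlinarith
  have h2 : P⁻¹ = Real.exp (-Real.log P) := by rw [Real.exp_neg, Real.exp_log hP0]
  rw [h2] at h1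
  refine h1.trans ?_
  rw [Real.exp_le_exp]
  rcases hlogP.eq_or_lt with h0 | hpos
  · rw [← h0]; simp
  · rw [neg_mul, neg_div, neg_le_neg_iff, div_le_iff₀ hpos]
    calc c * LN ≤ 1 * Real.log P ^ 2 := mul_le_mul hc1 hLN hLN0 zero_le_one
      _ = Real.log P * Real.log P := by ring

end Literature.NumberTheory.Sieve.MontgomeryVaughan1975
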